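import Summits.QuantumFields.YangMills.Theorems.UnitScaleTiltProp7SectET3CurvedPropagatorsT3Rows
import Summits.QuantumFields.YangMills.Theorems.UnitScaleTiltProp7SectET3NablaDict
import Summits.QuantumFields.YangMills.Theorems.UnitScaleTiltProp7SectET3DeltaPiT3
import HarnessLib

/-!
# Route `UnitScaleTilt`, crux «MinimiserStabilityRegPr» (stmt-QuantumFields-19200, stub EX `stub_existenceMinimalOrbit`), route (α), node N06(d = 3) —
# **THE (46) ROWS OF THE CHART'S `H` — VALUE AND COVARIANT GRADIENT — ARE THE (115)-NORM ROW OF THE SAME OPERATOR'S `Space115` READER** (the sub-row `h46∇` of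
# ★★OWNER RULING g27-№7 (3) ∕ desk `ym-inputs-plan-1` g15-2 (e), reduced BY NAME to a `norm_H₁`-shaped row; def-free, Δx-generic, no estimate)

Cell `ym3-torus` (HUMAN RULING D-0037, YM ladder rung R3 — YM₃ on T³ is a rung, NOT d = 4, NOT a mass gap, NOT Clay), width seat `ym3-torus-px18` (gen 0).
THEOREMS ONLY (0 `def`, 0 `sorry`); `--supports stmt-QuantumFields-19200 --as helper`; count-neutral.  Nothing of [Balaban1985Variational] ∕
[Balaban1985BackgroundPropagators] is asserted: bookkeeping identities over three landed files.

THE PRINT.  [Balaban1985Variational] (46) p. 285: *«|HB|, |∇_{U₀}HB| ≤ B₀|B|»* for the operator `H = GQ*(QGQ*)⁻¹` of (45) ([Balaban1985BackgroundPropagators] (3.126) p. 420,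
bounds (3.133) p. 422 at the orders n = 0, 1); (115) p. 294: the norm `‖A‖ = max{|A|₍₋₁₎, |∇_{U₀}A|₍₋₂₎}`; (19) p. 281: the four sizes of an exponent `X = ηA`, of which the
route's `Prop7TPrint.nMax19 U₀ X` takes the maximum (`‖X‖∕η`, `‖∇¹_{U₀}X‖∕η²`, `‖D¹*D¹X‖∕η³`, `‖Δ¹X‖∕η³`).

WHY (LOCATE of this seat, 2026-08-28).  The EX knit of record ✓`Prop7StubEXOfChartPiecesTwS6.stubEX_of_chartPiecesTwS6` displays the chart's `H` through `h46tw` with the VALUE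
row only (`‖H Y‖ ≤ BH·η·‖Y‖`); its row `hSize19` needs the order-1 member `‖∇¹_{U₀}(H Y)‖∕η²` of `nMax19` as well («`h46∇`», INPUT-LIST v15 I-02 standing sub-row).  The layer-0
letters of cell `ym-inputs` (✓`Prop7SectET3CurvedPropagators`) define BOTH the chart's `H := Hf … Δx U₀ = η • (toL2⁻¹ ∘ HT ∘ toL2B)` (plain functions) AND the (115)-valued
reader `H1f … Δx U₀ = H1CLM(HT) ∘ piIsoNegSize0` of the SAME Hilbert-level total letter `HT … Δx U₀` — generic in the Hessian slot `Δx` (`Δ_π` for print's `H`, `Δ₁` for `H₁`).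
So, by ✓`iota_H1f_eq` + ✓`Hf_apply`, `Hf Y = η • ι(H1f Y)` on the route carrier, and by ✓`Prop7SectET3NablaDict.norm115_cfgEquiv_eq` the (115)-norm of `H1f Y` IS
`max ‖Z‖ (η⁻¹·‖∇¹_{U₀}Z‖_sup)` for `Z = η⁻¹·Hf Y`, where `∇¹_{U₀}` is LETTER FOR LETTER the route's `covGradT 1 (bgUnits U₀)` of `nMax19` (index swap only).  Hence ONE row
`‖H1f … Δx U₀ Y‖₍₁₁₅₎ ≤ B·‖Y‖` — the text of the display's `norm_H₁` with the slot `Δx` (supplier-of-record shape: KH1 ✓`Prop7SectET3NormHRowAtOpsT3.normH₁_row_at_opsT3`, `Hsel := Hk`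
for `Δx = Δ_π`, modulo its displayed rows) — gives BOTH (46) rows of the chart's `H`: `‖Hf Y‖ ≤ B·η·‖Y‖` (= `h46tw`'s bound clause) and `‖covGradT 1 (bgUnits U₀) (Hf Y) μ ν x‖ ≤ B·η²·‖Y‖`
(= `h46∇`).  No new analytic row: the order-1 content was always inside the (115)-norm.

WHAT IS PROVED (ns `…Theorems.Prop7H46GradRow`).
* §0 two letters of `T3SectALandauChart.covGradT` at spacing `1`: `covGradT_one_apply` (the route letter `R(U₀(x,μ))X(x+e_μ,ν) − X(x,ν)`), `covGradT_one_smul` (ℂ-linearity).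
* §1a GENERIC (any `f` of the space (115) on the diagonal, read on the route carrier as `ι f := fun b ↦ (JetSup.equiv f)(bondEquiv b)`): `jet_eq_cfgEquiv_iota`, ★`norm_iota_apply_le`
  (`‖ι f b‖ ≤ ‖f‖`), ★★`norm_covGradT_iota_le` (`‖covGradT 1 (bgUnits U₀) (ι f) μ ν x‖ ≤ η·‖f‖`), ★★`orders01_of_eta_smul_iota` (exponent scale `X = (η·c)•ι f`, `|c| ≤ 1`: orders 0, 1 of
  `nMax19` are `≤ ‖f‖₍₁₁₅₎`) — serves the pieces `ηi·ιA₁`, `ηi·ι(H₁f B)` of the chart exponent as well.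
* §1b member level, the chart's `H` (any `F n K h c₀ cB a Δx U₀`): ★`Hf_eq_eta_smul_iota_H1f`, `jet_H1f_eq_cfgEquiv`, ★`norm_iota_H1f_le` ∕ ★`norm_covGradT_iota_H1f_le` (value ∕ unit-spacing gradient of
  `ι(H1f Y)` under `‖H1f Y‖₍₁₁₅₎ ≤ c`: `≤ c` ∕ `≤ η·c`), ★★`norm_Hf_apply_le_of_norm115_le`, ★★`norm_Hf_le_of_norm115_le` (`‖Hf Y‖ ≤ η·c`), ★★★`norm_covGradT_Hf_le_of_norm115_le`
  (`‖covGradT 1 (bgUnits F K U₀) (Hf Y) μ ν x‖ ≤ η²·c`), ★★★`h46_rows_of_norm115` (operator form, constant `B`).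
* §2 the EX binder families (`∀ L, 1 < L → ∀ (i : Idx L) U₀, RegPr … (α L) U₀ → …`, letters `H := Hf … (Δx L i) U₀` as in ✓`Prop7SectET3EXJunction`): from the `norm_H₁`-shaped row
  `norm_H` for `H1f … (Δx L i)` conclude ★★★`h46sup_of_normH` (`h46tw`'s clause `‖H Y‖ ≤ BH L * eta * ‖Y‖` VERBATIM with `BH := B₀`) and ★★★`h46grad_of_normH` (the gradient row).
* §3 print's `H` (3.126) = the NAMED letter ✓`Prop7SectET3DeltaPi.H46 … U₀ := Hf … (DeltaPiSlot …) U₀` (supplier of record of `h46tw`'s `H`, RULING g26-№10∕№12 (3)): ★★★`h46_rows_H46_of_norm115`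
  — both (46) rows of `H46 U₀` from `‖H1f … (DeltaPiSlot …) U₀ Y‖₍₁₁₅₎ ≤ B·‖Y‖` (the `norm_H₁` text at the slot `Δ_π`; KH1 with `Hsel := Hk`).
HONEST SCOPE.  Re-indexing, one scalar, `max`-bookkeeping; the (115)-norm row itself (N06(d = 3), [B9] Thm 3.12 ∕ (3.133)) stays DISPLAYED; the order-2 members of `nMax19`
(`hΔsol`, `hΔH`) are untouched; nothing here claims EX, the crux, V3∕R3, d = 4 or the mass gap.

References: T. Bałaban, CMP **102** (1985) 277–309 [Balaban1985Variational] ((45)–(46) p.285, (19) p.281, (115) p.294, (103) p.293); CMP **99** (1985) 389–434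
[Balaban1985BackgroundPropagators] ((3.3) p.391, (3.126) p.420, (3.133) p.422).
-/

set_option autoImplicit false

noncomputable section

open scoped Matrix.Norms.L2Operator BigOperators

namespace Summit.QuantumFields.YangMills.Theorems.Prop7H46GradRow

open Literature.MathematicalPhysics.QuantumFieldTheory.Balaban1983to89
open Literature.MathematicalPhysics.QuantumFieldTheory.Balaban1983to89.T3ContinuumYM3Torus
open Literature.MathematicalPhysics.QuantumFieldTheory.Balaban1983to89.T3Thm1Carrier (Idx)
open Literature.MathematicalPhysics.QuantumFieldTheory.Balaban1983to89.T3PrintedRegularMinimiser (RegPr)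
open Literature.MathematicalPhysics.QuantumFieldTheory.Balaban1983to89.B10Eq27TorusAxialLog (toUField unitsField)
open Literature.MathematicalPhysics.QuantumFieldTheory.Balaban1983to89.B7Eq78Linearization (conjR conjR_smul)
open T3SectALandauChart (eta eta_pos bgUnits covGradT covDerivFwdT formComp)
open B9SectCLatticeCarrier (Bond)
open B11Eq115Space (NegSize NegSup Space115 JetSup)
open B11Eq111FrakG (nabla115)
open B11Eq103H1Complex (BondL2K)
open Summit.QuantumFields.YangMills.Theorems.Prop7SectET3Transport (periodsT3 bondEquiv cfgEquiv cfgEquiv_apply norm_cfgEquiv bgOfCfg siteEquiv)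
open Summit.QuantumFields.YangMills.Theorems.Prop7SectET3HilbertLetters (W₂ toL2 toL2B)
open Summit.QuantumFields.YangMills.Theorems.Prop7SectET3CurvedPropagators
open Summit.QuantumFields.YangMills.Theorems.Prop7SectET3NablaDict (norm115_cfgEquiv_eq norm_space115_diag_eq)
open Summit.QuantumFields.YangMills.Theorems.Prop7SectET3DeltaPi (DeltaPiSlot H46)

/-! ## §0 Two letters of the route's covariant gradient at spacing `1` -/

section Calculus

variable {P : Params} {s : ℕ} {𝔸 : Type*} [NormedRing 𝔸] [NormedAlgebra ℂ 𝔸]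

/-- At spacing `1` the `(μ, ν)`-component of the route's covariant gradient is the bare covariant difference `R(V(x,μ))X(x + e_μ, ν) − X(x, ν)` — the letter of
✓`Prop7SectET3NablaDict` read at the index `(⟨x, ν⟩, μ)`. [cite: Balaban1985RegularSpaces, (1.1) p.76; Balaban1985Variational, (19) p.281] -/
theorem covGradT_one_apply (V : GaugeField P s 𝔸ˣ) (X : PBond P s → 𝔸) (μ ν : Fin P.d) (x : Site P s) :
    covGradT 1 V X μ ν x = conjR (V ⟨x, μ⟩) (X ⟨x.shift μ, ν⟩) - X ⟨x, ν⟩ := by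
  simp only [covGradT, covDerivFwdT, formComp, inv_one, one_smul]

/-- `∇¹_V` is ℂ-linear in the one-form: `∇¹_V(c•X) = c•∇¹_V X` componentwise. [cite: Balaban1985RegularSpaces, (1.1) p.76] -/
theorem covGradT_one_smul (V : GaugeField P s 𝔸ˣ) (c : ℂ) (X : PBond P s → 𝔸) (μ ν : Fin P.d) (x : Site P s) :
    covGradT 1 V (c • X) μ ν x = c • covGradT 1 V X μ ν x := by
  simp only [covGradT_one_apply, Pi.smul_apply, conjR_smul, smul_sub]

end Calculus

/-! ## §1 Member level: the chart's `H` is `η` times its (115)-reader; both (46) rows from the (115)-norm -/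

section Member

variable (F : T3Family) (n K : ℕ) (h : n ≤ K) (c₀ cB a : ℝ) [Fact (0 < c₀)] [Fact (0 < cB)]
  (Δx : GaugeField (F.P K) 0 (Matrix.specialUnitaryGroup (Fin 2) ℂ) → (BondL2K ℂ 3 (periodsT3 F K) c₀ W₂ →ₗ[ℂ] BondL2K ℂ 3 (periodsT3 F K) c₀ W₂))
  [Fact (0 < (F.L : ℝ))] [Fact (0 < ((F.L : ℝ)⁻¹) ^ (K - n))]

/-! ### §1a The generic (115) → (19) dictionary at orders 0, 1: ANY element of the space (115) read on the route carrier -/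

omit [Fact (0 < (F.L : ℝ))] [Fact (0 < ((F.L : ℝ)⁻¹) ^ (K - n))] in
/-- For ANY `f` of the space (115) on the diagonal, its bond function IS the `cfgEquiv`-transport of its route reading `ι f := fun b ↦ (JetSup.equiv f)(bondEquiv b)`
(tautological re-indexing; the hypothesis shape of ✓`norm115_cfgEquiv_eq`). [cite: Balaban1985Variational, (115) p.294] -/
theorem jet_eq_cfgEquiv_iota (U₀ : GaugeField (F.P K) 0 (Matrix.specialUnitaryGroup (Fin 2) ℂ))
    (f : Space115 (F.L : ℝ) (((F.L : ℝ)⁻¹) ^ (K - n)) (fun _ : Bond 3 (periodsT3 F K) => K - n) (fun _ : Bond 3 (periodsT3 F K) × Fin 3 => K - n)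
      (nabla115 (((F.L : ℝ)⁻¹) ^ (K - n)) (bgOfCfg F K U₀))) :
    JetSup.equiv _ _ _ f = cfgEquiv F K _ (fun b : PBond (F.P K) 0 => JetSup.equiv _ _ _ f (bondEquiv F K b)) := by
  funext p
  rw [cfgEquiv_apply]
  simp only [Equiv.apply_symm_apply]

/-- ★ **ORDER 0 FOR ANY (115)-LETTER**: `‖(ι f)(b)‖ ≤ ‖f‖₍₁₁₅₎` — serves the pieces `ιA₁`, `ι(H₁f B)`, `ι(𝒢f f)` of the chart exponent alike. [cite: Balaban1985Variational, (115) p.294, (19) p.281] -/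
theorem norm_iota_apply_le (U₀ : GaugeField (F.P K) 0 (Matrix.specialUnitaryGroup (Fin 2) ℂ))
    (f : Space115 (F.L : ℝ) (((F.L : ℝ)⁻¹) ^ (K - n)) (fun _ : Bond 3 (periodsT3 F K) => K - n) (fun _ : Bond 3 (periodsT3 F K) × Fin 3 => K - n)
      (nabla115 (((F.L : ℝ)⁻¹) ^ (K - n)) (bgOfCfg F K U₀))) (b : PBond (F.P K) 0) :
    ‖JetSup.equiv _ _ _ f (bondEquiv F K b)‖ ≤ ‖f‖ := by
  refine (norm_le_pi_norm _ (bondEquiv F K b)).trans ?_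
  rw [norm_space115_diag_eq (K - n) _ f]
  exact le_max_left _ _

/-- ★★ **ORDER 1 FOR ANY (115)-LETTER**: `‖covGradT 1 (bgUnits U₀) (ι f) μ ν x‖ ≤ η·‖f‖₍₁₁₅₎` — the `nMax19` gradient member of `ι f` is `≤ η⁻¹·‖f‖₍₁₁₅₎`; with the exponent
scale `X = η·(…)` of the chart both members of orders 0, 1 are `≤ ‖f‖₍₁₁₅₎`. [cite: Balaban1985Variational, (115) p.294, (19) p.281; Balaban1985BackgroundPropagators, (3.3) p.391] -/
theorem norm_covGradT_iota_le (U₀ : GaugeField (F.P K) 0 (Matrix.specialUnitaryGroup (Fin 2) ℂ))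
    (f : Space115 (F.L : ℝ) (((F.L : ℝ)⁻¹) ^ (K - n)) (fun _ : Bond 3 (periodsT3 F K) => K - n) (fun _ : Bond 3 (periodsT3 F K) × Fin 3 => K - n)
      (nabla115 (((F.L : ℝ)⁻¹) ^ (K - n)) (bgOfCfg F K U₀))) (μ ν : Fin (F.P K).d) (x : Site (F.P K) 0) :
    ‖covGradT 1 (bgUnits F K U₀) (fun b : PBond (F.P K) 0 => JetSup.equiv _ _ _ f (bondEquiv F K b)) μ ν x‖ ≤ eta F n K * ‖f‖ := by
  set Z : PBond (F.P K) 0 → Matrix (Fin 2) (Fin 2) ℂ := fun b : PBond (F.P K) 0 => JetSup.equiv _ _ _ f (bondEquiv F K b) with hZ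
  have hη : 0 < eta F n K := eta_pos F n K
  have hnorm := norm115_cfgEquiv_eq F K (K - n) U₀ Z f (jet_eq_cfgEquiv_iota F n K U₀ f)
  have hS : |((F.L : ℝ)⁻¹) ^ (K - n)|⁻¹ *
      ‖fun q : PBond (F.P K) 0 × Fin (F.P K).d => conjR (unitsField (toUField U₀) ⟨q.1.src, q.2⟩) (Z ⟨q.1.src.shift q.2, q.1.dir⟩) - Z q.1‖ ≤ ‖f‖ := by
    rw [hnorm]; exact le_max_right _ _
  have habs : |((F.L : ℝ)⁻¹) ^ (K - n)| = eta F n K := abs_of_pos hη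
  rw [habs] at hS
  have hq : ‖conjR (unitsField (toUField U₀) ⟨x, μ⟩) (Z ⟨x.shift μ, ν⟩) - Z ⟨x, ν⟩‖ ≤
      ‖fun q : PBond (F.P K) 0 × Fin (F.P K).d => conjR (unitsField (toUField U₀) ⟨q.1.src, q.2⟩) (Z ⟨q.1.src.shift q.2, q.1.dir⟩) - Z q.1‖ :=
    norm_le_pi_norm (fun q : PBond (F.P K) 0 × Fin (F.P K).d =>
      conjR (unitsField (toUField U₀) ⟨q.1.src, q.2⟩) (Z ⟨q.1.src.shift q.2, q.1.dir⟩) - Z q.1) (⟨x, ν⟩, μ)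
  rw [covGradT_one_apply]
  calc ‖conjR (bgUnits F K U₀ ⟨x, μ⟩) (Z ⟨x.shift μ, ν⟩) - Z ⟨x, ν⟩‖
      ≤ ‖fun q : PBond (F.P K) 0 × Fin (F.P K).d => conjR (unitsField (toUField U₀) ⟨q.1.src, q.2⟩) (Z ⟨q.1.src.shift q.2, q.1.dir⟩) - Z q.1‖ := hq
    _ = eta F n K * ((eta F n K)⁻¹ *
          ‖fun q : PBond (F.P K) 0 × Fin (F.P K).d => conjR (unitsField (toUField U₀) ⟨q.1.src, q.2⟩) (Z ⟨q.1.src.shift q.2, q.1.dir⟩) - Z q.1‖) := by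
        rw [← mul_assoc, mul_inv_cancel₀ hη.ne', one_mul]
    _ ≤ eta F n K * ‖f‖ := mul_le_mul_of_nonneg_left hS hη.le

/-- ★★ **THE EXPONENT-SCALE FORM FOR ANY (115)-LETTER**: for `X := ((η:ℂ)·c) • ι f` (the chart's `A′`-pieces `ηi·ιA₁`, `ηi·ι(H₁B)`, `|c| ≤ 1`), `‖X b‖ ≤ η·‖f‖` and
`‖covGradT 1 (bgUnits U₀) X μ ν x‖ ≤ η²·‖f‖` — both `nMax19` members of orders 0, 1 are `≤ ‖f‖₍₁₁₅₎`. [cite: Balaban1985Variational, (19) p.281, (115) p.294] -/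
theorem orders01_of_eta_smul_iota (U₀ : GaugeField (F.P K) 0 (Matrix.specialUnitaryGroup (Fin 2) ℂ))
    (f : Space115 (F.L : ℝ) (((F.L : ℝ)⁻¹) ^ (K - n)) (fun _ : Bond 3 (periodsT3 F K) => K - n) (fun _ : Bond 3 (periodsT3 F K) × Fin 3 => K - n)
      (nabla115 (((F.L : ℝ)⁻¹) ^ (K - n)) (bgOfCfg F K U₀))) (c : ℂ) (hc : ‖c‖ ≤ 1) :
    (∀ b : PBond (F.P K) 0, ‖((((eta F n K : ℝ) : ℂ)) * c) • JetSup.equiv _ _ _ f (bondEquiv F K b)‖ ≤ eta F n K * ‖f‖) ∧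
    (∀ (μ ν : Fin (F.P K).d) (x : Site (F.P K) 0),
      ‖covGradT 1 (bgUnits F K U₀) ((((eta F n K : ℝ) : ℂ) * c) • fun b : PBond (F.P K) 0 => JetSup.equiv _ _ _ f (bondEquiv F K b)) μ ν x‖ ≤
        eta F n K ^ 2 * ‖f‖) := by
  have hη : 0 < eta F n K := eta_pos F n K
  have hsc : ‖(((eta F n K : ℝ) : ℂ)) * c‖ ≤ eta F n K := by
    rw [norm_mul, Complex.norm_real, Real.norm_eq_abs, abs_of_pos hη]
    exact mul_le_of_le_one_right hη.le hc
  refine ⟨fun b => ?_, fun μ ν x => ?_⟩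
  · rw [norm_smul]
    exact mul_le_mul hsc (norm_iota_apply_le F n K U₀ f b) (norm_nonneg _) hη.le
  · rw [covGradT_one_smul, norm_smul, sq, mul_assoc]
    exact mul_le_mul hsc (norm_covGradT_iota_le F n K U₀ f μ ν x) (norm_nonneg _) hη.le

/-! ### §1b The chart's `H` -/

/-- ★ **`Hf Y = η • ι(H1f Y)`**: the chart's `H` (exponent scale, plain functions on the route carrier) IS `η` times the (115)-valued reader of the same total letter `HT`, read back
along `bondEquiv` — ✓`Hf_apply` + ✓`iota_H1f_eq`. [cite: Balaban1985Variational, (45) p.285, (103) p.293; Balaban1985BackgroundPropagators, (3.126) p.420] -/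
theorem Hf_eq_eta_smul_iota_H1f (U₀ : GaugeField (F.P K) 0 (Matrix.specialUnitaryGroup (Fin 2) ℂ)) (Y : PBond (F.P n) 0 → Matrix (Fin 2) (Fin 2) ℂ) :
    Hf F n K h c₀ cB a Δx U₀ Y =
      (((eta F n K : ℝ) : ℂ)) • fun b : PBond (F.P K) 0 => JetSup.equiv _ _ _ (H1f F n K h c₀ cB a Δx U₀ Y) (bondEquiv F K b) := by
  rw [Hf_apply, iota_H1f_eq]

/-- The bond function underlying `H1f Y` is the `cfgEquiv`-transport of the route function `toL2⁻¹(HT(toL2B Y))` (the hypothesis shape of ✓`norm115_cfgEquiv_eq`).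
[cite: Balaban1985Variational, (103) p.293, (115) p.294] -/
theorem jet_H1f_eq_cfgEquiv (U₀ : GaugeField (F.P K) 0 (Matrix.specialUnitaryGroup (Fin 2) ℂ)) (Y : PBond (F.P n) 0 → Matrix (Fin 2) (Fin 2) ℂ) :
    JetSup.equiv _ _ _ (H1f F n K h c₀ cB a Δx U₀ Y) = cfgEquiv F K _ ((toL2 F K c₀).symm (HT F n K h c₀ cB a Δx U₀ (toL2B F n cB Y))) := by
  funext p
  rw [cfgEquiv_apply, ← iota_H1f_eq]
  simp only [Equiv.apply_symm_apply]

/-- ★ The VALUE of `ι(H1f Y)` at every bond is within the (115)-norm: `‖ι(H1f Y)(p)‖ ≤ ‖H1f Y‖₍₁₁₅₎` (on the diagonal the (115)-norm is `max ‖·‖_sup ‖∇·‖_sup`).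
[cite: Balaban1985Variational, (115) p.294] -/
theorem norm_iota_H1f_apply_le (U₀ : GaugeField (F.P K) 0 (Matrix.specialUnitaryGroup (Fin 2) ℂ)) (Y : PBond (F.P n) 0 → Matrix (Fin 2) (Fin 2) ℂ)
    (p : Bond 3 (periodsT3 F K)) :
    ‖JetSup.equiv _ _ _ (H1f F n K h c₀ cB a Δx U₀ Y) p‖ ≤ ‖H1f F n K h c₀ cB a Δx U₀ Y‖ := by
  refine (norm_le_pi_norm _ p).trans ?_
  rw [norm_space115_diag_eq (K - n) _ (H1f F n K h c₀ cB a Δx U₀ Y)]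
  exact le_max_left _ _

/-- ★ The unit-spacing COVARIANT GRADIENT of the route function `toL2⁻¹(HT(toL2B Y))` underlying `H1f Y` is within `η` times the (115)-norm:
`‖covGradT 1 (bgUnits U₀) Z μ ν x‖ ≤ η·‖H1f Y‖₍₁₁₅₎` — ✓`norm115_cfgEquiv_eq` read at the index `(⟨x, ν⟩, μ)`. [cite: Balaban1985Variational, (115) p.294; Balaban1985BackgroundPropagators, (3.3) p.391] -/
theorem norm_covGradT_toL2symm_HT_le (U₀ : GaugeField (F.P K) 0 (Matrix.specialUnitaryGroup (Fin 2) ℂ)) (Y : PBond (F.P n) 0 → Matrix (Fin 2) (Fin 2) ℂ)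
    (μ ν : Fin (F.P K).d) (x : Site (F.P K) 0) :
    ‖covGradT 1 (bgUnits F K U₀) ((toL2 F K c₀).symm (HT F n K h c₀ cB a Δx U₀ (toL2B F n cB Y))) μ ν x‖ ≤
      eta F n K * ‖H1f F n K h c₀ cB a Δx U₀ Y‖ := by
  set Z : PBond (F.P K) 0 → Matrix (Fin 2) (Fin 2) ℂ := (toL2 F K c₀).symm (HT F n K h c₀ cB a Δx U₀ (toL2B F n cB Y)) with hZ
  have hη : 0 < eta F n K := eta_pos F n K
  have hnorm := norm115_cfgEquiv_eq F K (K - n) U₀ Z (H1f F n K h c₀ cB a Δx U₀ Y) (jet_H1f_eq_cfgEquiv F n K h c₀ cB a Δx U₀ Y)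
  -- `|η|⁻¹ · S ≤ ‖H1f Y‖`, `S` the sup of the route letters
  have hS : |((F.L : ℝ)⁻¹) ^ (K - n)|⁻¹ *
      ‖fun q : PBond (F.P K) 0 × Fin (F.P K).d => conjR (unitsField (toUField U₀) ⟨q.1.src, q.2⟩) (Z ⟨q.1.src.shift q.2, q.1.dir⟩) - Z q.1‖ ≤
      ‖H1f F n K h c₀ cB a Δx U₀ Y‖ := by
    rw [hnorm]; exact le_max_right _ _
  have habs : |((F.L : ℝ)⁻¹) ^ (K - n)| = eta F n K := abs_of_pos hη
  rw [habs] at hS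
  -- the entry `(⟨x, ν⟩, μ)` of the sup
  have hq : ‖conjR (unitsField (toUField U₀) ⟨x, μ⟩) (Z ⟨x.shift μ, ν⟩) - Z ⟨x, ν⟩‖ ≤
      ‖fun q : PBond (F.P K) 0 × Fin (F.P K).d => conjR (unitsField (toUField U₀) ⟨q.1.src, q.2⟩) (Z ⟨q.1.src.shift q.2, q.1.dir⟩) - Z q.1‖ :=
    norm_le_pi_norm (fun q : PBond (F.P K) 0 × Fin (F.P K).d =>
      conjR (unitsField (toUField U₀) ⟨q.1.src, q.2⟩) (Z ⟨q.1.src.shift q.2, q.1.dir⟩) - Z q.1) (⟨x, ν⟩, μ)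
  rw [covGradT_one_apply]
  calc ‖conjR (bgUnits F K U₀ ⟨x, μ⟩) (Z ⟨x.shift μ, ν⟩) - Z ⟨x, ν⟩‖
      ≤ ‖fun q : PBond (F.P K) 0 × Fin (F.P K).d => conjR (unitsField (toUField U₀) ⟨q.1.src, q.2⟩) (Z ⟨q.1.src.shift q.2, q.1.dir⟩) - Z q.1‖ := hq
    _ = eta F n K * ((eta F n K)⁻¹ *
          ‖fun q : PBond (F.P K) 0 × Fin (F.P K).d => conjR (unitsField (toUField U₀) ⟨q.1.src, q.2⟩) (Z ⟨q.1.src.shift q.2, q.1.dir⟩) - Z q.1‖) := by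
        rw [← mul_assoc, mul_inv_cancel₀ hη.ne', one_mul]
    _ ≤ eta F n K * ‖H1f F n K h c₀ cB a Δx U₀ Y‖ := mul_le_mul_of_nonneg_left hS hη.le

/-- ★★ **THE VALUE ROW (46)₀ AT ONE BOND**: `‖H1f Y‖₍₁₁₅₎ ≤ c ⟹ ‖(Hf Y)(b)‖ ≤ η·c`. [cite: Balaban1985Variational, (46) p.285, (115) p.294] -/
theorem norm_Hf_apply_le_of_norm115_le (U₀ : GaugeField (F.P K) 0 (Matrix.specialUnitaryGroup (Fin 2) ℂ)) (Y : PBond (F.P n) 0 → Matrix (Fin 2) (Fin 2) ℂ)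
    {c : ℝ} (hc : ‖H1f F n K h c₀ cB a Δx U₀ Y‖ ≤ c) (b : PBond (F.P K) 0) :
    ‖Hf F n K h c₀ cB a Δx U₀ Y b‖ ≤ eta F n K * c := by
  have hη : 0 < eta F n K := eta_pos F n K
  rw [Hf_eq_eta_smul_iota_H1f, Pi.smul_apply, norm_smul, Complex.norm_real, Real.norm_eq_abs, abs_of_pos hη]
  exact mul_le_mul_of_nonneg_left ((norm_iota_H1f_apply_le F n K h c₀ cB a Δx U₀ Y _).trans hc) hη.le

/-- ★★ **THE VALUE ROW (46)₀, SUP FORM**: `‖H1f Y‖₍₁₁₅₎ ≤ c ⟹ ‖Hf Y‖ ≤ η·c` (sup norm on the route carrier). [cite: Balaban1985Variational, (46) p.285, (115) p.294] -/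
theorem norm_Hf_le_of_norm115_le (U₀ : GaugeField (F.P K) 0 (Matrix.specialUnitaryGroup (Fin 2) ℂ)) (Y : PBond (F.P n) 0 → Matrix (Fin 2) (Fin 2) ℂ)
    {c : ℝ} (hc : ‖H1f F n K h c₀ cB a Δx U₀ Y‖ ≤ c) :
    ‖Hf F n K h c₀ cB a Δx U₀ Y‖ ≤ eta F n K * c :=
  pi_norm_le_iff_of_nonneg (mul_nonneg (eta_pos F n K).le ((norm_nonneg _).trans hc)) |>.mpr
    fun b => norm_Hf_apply_le_of_norm115_le F n K h c₀ cB a Δx U₀ Y hc b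

/-- ★★★ **THE GRADIENT ROW (46)₁ = `h46∇`**: `‖H1f Y‖₍₁₁₅₎ ≤ c ⟹ ‖covGradT 1 (bgUnits U₀) (Hf Y) μ ν x‖ ≤ η²·c` — the order-1 member of `Prop7TPrint.nMax19 U₀ (Hf Y)` is `≤ c`.
[cite: Balaban1985Variational, (46) p.285, (19) p.281, (115) p.294; Balaban1985BackgroundPropagators, (3.133) p.422] -/
theorem norm_covGradT_Hf_le_of_norm115_le (U₀ : GaugeField (F.P K) 0 (Matrix.specialUnitaryGroup (Fin 2) ℂ)) (Y : PBond (F.P n) 0 → Matrix (Fin 2) (Fin 2) ℂ)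
    {c : ℝ} (hc : ‖H1f F n K h c₀ cB a Δx U₀ Y‖ ≤ c) (μ ν : Fin (F.P K).d) (x : Site (F.P K) 0) :
    ‖covGradT 1 (bgUnits F K U₀) (Hf F n K h c₀ cB a Δx U₀ Y) μ ν x‖ ≤ eta F n K ^ 2 * c := by
  have hη : 0 < eta F n K := eta_pos F n K
  rw [Hf_apply, covGradT_one_smul, norm_smul, Complex.norm_real, Real.norm_eq_abs, abs_of_pos hη, sq, mul_assoc]
  exact mul_le_mul_of_nonneg_left ((norm_covGradT_toL2symm_HT_le F n K h c₀ cB a Δx U₀ Y μ ν x).trans (mul_le_mul_of_nonneg_left hc hη.le)) hη.le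

/-- ★★★ **BOTH (46) ROWS OF THE CHART'S `H`, OPERATOR FORM**: from the (115)-norm row `‖H1f Y‖ ≤ B·‖Y‖` (the display's `norm_H₁` text with the slot `Δx`):
`‖Hf Y‖ ≤ B·η·‖Y‖` (the bound clause of `h46tw`) and `‖covGradT 1 (bgUnits U₀) (Hf Y) μ ν x‖ ≤ B·η²·‖Y‖` (`h46∇`).
[cite: Balaban1985Variational, (45)–(46) p.285, (115) p.294; Balaban1985BackgroundPropagators, (3.126) p.420, (3.133) p.422] -/
theorem h46_rows_of_norm115 (U₀ : GaugeField (F.P K) 0 (Matrix.specialUnitaryGroup (Fin 2) ℂ)) {B : ℝ}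
    (hB : ∀ Y : PBond (F.P n) 0 → Matrix (Fin 2) (Fin 2) ℂ, ‖H1f F n K h c₀ cB a Δx U₀ Y‖ ≤ B * ‖Y‖) :
    (∀ Y : PBond (F.P n) 0 → Matrix (Fin 2) (Fin 2) ℂ, ‖Hf F n K h c₀ cB a Δx U₀ Y‖ ≤ B * eta F n K * ‖Y‖) ∧
    (∀ (Y : PBond (F.P n) 0 → Matrix (Fin 2) (Fin 2) ℂ) (μ ν : Fin (F.P K).d) (x : Site (F.P K) 0),
      ‖covGradT 1 (bgUnits F K U₀) (Hf F n K h c₀ cB a Δx U₀ Y) μ ν x‖ ≤ B * eta F n K ^ 2 * ‖Y‖) := by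
  refine ⟨fun Y => ?_, fun Y μ ν x => ?_⟩
  · have := norm_Hf_le_of_norm115_le F n K h c₀ cB a Δx U₀ Y (hB Y)
    calc ‖Hf F n K h c₀ cB a Δx U₀ Y‖ ≤ eta F n K * (B * ‖Y‖) := this
      _ = B * eta F n K * ‖Y‖ := by ring
  · have := norm_covGradT_Hf_le_of_norm115_le F n K h c₀ cB a Δx U₀ Y (hB Y) μ ν x
    calc ‖covGradT 1 (bgUnits F K U₀) (Hf F n K h c₀ cB a Δx U₀ Y) μ ν x‖ ≤ eta F n K ^ 2 * (B * ‖Y‖) := this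
      _ = B * eta F n K ^ 2 * ‖Y‖ := by ring

end Member

/-! ## §3 Print's `H` (3.126): both (46) rows at the NAMED letter `H46 := Hf … (DeltaPiSlot …)` -/

section PrintH

variable (F : T3Family) (n K : ℕ) (h : n ≤ K) (c₀ cB a : ℝ) [Fact (0 < c₀)] [Fact (0 < cB)]
  [Fact (0 < (F.L : ℝ))] [Fact (0 < ((F.L : ℝ)⁻¹) ^ (K - n))]

/-- ★★★ **BOTH (46) ROWS OF PRINT'S `H = GQ*(QGQ*)⁻¹` AT THE MEMBER, i.e. of the named letter `H46 U₀ = Hf … (Δ_π-slot) U₀`** (the supplier of record of `h46tw`'s `H`), from the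
(115)-norm row of its reader `H1f … (Δ_π-slot) U₀` (the display's `norm_H₁` text at the slot `Δ_π`): `‖H46 U₀ Y‖ ≤ B·η·‖Y‖` and `‖covGradT 1 (bgUnits U₀) (H46 U₀ Y) μ ν x‖ ≤ B·η²·‖Y‖`.
[cite: Balaban1985Variational, (45)–(46) p.285, (115) p.294; Balaban1985BackgroundPropagators, (3.126) p.420, (3.133) p.422] -/
theorem h46_rows_H46_of_norm115 (U₀ : GaugeField (F.P K) 0 (Matrix.specialUnitaryGroup (Fin 2) ℂ)) {B : ℝ}
    (hB : ∀ Y : PBond (F.P n) 0 → Matrix (Fin 2) (Fin 2) ℂ, ‖H1f F n K h c₀ cB a (DeltaPiSlot F n K h c₀ cB a) U₀ Y‖ ≤ B * ‖Y‖) :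
    (∀ Y : PBond (F.P n) 0 → Matrix (Fin 2) (Fin 2) ℂ, ‖H46 F n K h c₀ cB a U₀ Y‖ ≤ B * eta F n K * ‖Y‖) ∧
    (∀ (Y : PBond (F.P n) 0 → Matrix (Fin 2) (Fin 2) ℂ) (μ ν : Fin (F.P K).d) (x : Site (F.P K) 0),
      ‖covGradT 1 (bgUnits F K U₀) (H46 F n K h c₀ cB a U₀ Y) μ ν x‖ ≤ B * eta F n K ^ 2 * ‖Y‖) :=
  h46_rows_of_norm115 F n K h c₀ cB a (DeltaPiSlot F n K h c₀ cB a) U₀ hB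

end PrintH

/-! ## §2 The EX binder families: `h46tw`'s bound clause and `h46∇` from a `norm_H₁`-shaped row for `H1f … (Δx L i)` -/

section Family

variable [hFL : ∀ F : T3Family, Fact (0 < (F.L : ℝ))] [hFη : ∀ (F : T3Family) (k : ℕ), Fact (0 < ((F.L : ℝ)⁻¹) ^ k)]
variable {α : ℕ → ℝ} {c₀ cB a : ∀ L : ℕ, Idx L → ℝ} [hc₀ : ∀ (L : ℕ) (i : Idx L), Fact (0 < c₀ L i)] [hcB : ∀ (L : ℕ) (i : Idx L), Fact (0 < cB L i)]
  {Δx : ∀ (L : ℕ) (i : Idx L), GaugeField (i.1.1.P i.1.2.2) 0 (Matrix.specialUnitaryGroup (Fin 2) ℂ) →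
    (BondL2K ℂ 3 (periodsT3 i.1.1 i.1.2.2) (c₀ L i) W₂ →ₗ[ℂ] BondL2K ℂ 3 (periodsT3 i.1.1 i.1.2.2) (c₀ L i) W₂)}
  {B₀ : ℕ → ℝ}

/-- ★★★ **`h46tw`'S BOUND CLAUSE `‖H Y‖ ≤ BH L * η * ‖Y‖` FOR `H := Hf … (Δx L i) U₀`, `BH := B₀`, FROM THE `norm_H₁`-SHAPED ROW FOR `H1f … (Δx L i)`** (quantifier for quantifier as in
✓`Prop7StubEXOfChartPiecesTwS6`: `RegPr … (α L) U₀`; the row `norm_H` is asked at `ρ ≤ α L` like the display's `norm_H₁`). [cite: Balaban1985Variational, (46) p.285, (115) p.294, (117) p.295] -/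
theorem h46sup_of_normH
    (norm_H : ∀ (L : ℕ), 1 < L → ∀ (i : Idx L) (ρ : ℝ) (U₀ : GaugeField (i.1.1.P i.1.2.2) 0 (Matrix.specialUnitaryGroup (Fin 2) ℂ)),
      RegPr i.1.1 i.1.2.1 i.1.2.2 ρ U₀ → ρ ≤ α L → ∀ b, ‖H1f i.1.1 i.1.2.1 i.1.2.2 i.2.2.le (c₀ L i) (cB L i) (a L i) (Δx L i) U₀ b‖ ≤ B₀ L * ‖b‖) :
    ∀ (L : ℕ), 1 < L → ∀ (i : Idx L) (U₀ : GaugeField (i.1.1.P i.1.2.2) 0 (Matrix.specialUnitaryGroup (Fin 2) ℂ)), RegPr i.1.1 i.1.2.1 i.1.2.2 (α L) U₀ →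
      ∀ Y, ‖Hf i.1.1 i.1.2.1 i.1.2.2 i.2.2.le (c₀ L i) (cB L i) (a L i) (Δx L i) U₀ Y‖ ≤ B₀ L * eta i.1.1 i.1.2.1 i.1.2.2 * ‖Y‖ :=
  fun L hL i U₀ hU => (h46_rows_of_norm115 i.1.1 i.1.2.1 i.1.2.2 i.2.2.le (c₀ L i) (cB L i) (a L i) (Δx L i) U₀ (norm_H L hL i (α L) U₀ hU le_rfl)).1

/-- ★★★ **`h46∇` — THE GRADIENT ROW OF THE CHART'S `H` FOR `H := Hf … (Δx L i) U₀` FROM THE SAME `norm_H₁`-SHAPED ROW**: under `RegPr … (α L) U₀`,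
`‖covGradT 1 (bgUnits U₀) (H Y) μ ν x‖ ≤ B₀ L * η² * ‖Y‖` — the order-1 member of `nMax19 U₀ (H Y)` is `≤ B₀ L * ‖Y‖`. [cite: Balaban1985Variational, (46) p.285, (19) p.281, (115) p.294; Balaban1985BackgroundPropagators, (3.133) p.422] -/
theorem h46grad_of_normH
    (norm_H : ∀ (L : ℕ), 1 < L → ∀ (i : Idx L) (ρ : ℝ) (U₀ : GaugeField (i.1.1.P i.1.2.2) 0 (Matrix.specialUnitaryGroup (Fin 2) ℂ)),
      RegPr i.1.1 i.1.2.1 i.1.2.2 ρ U₀ → ρ ≤ α L → ∀ b, ‖H1f i.1.1 i.1.2.1 i.1.2.2 i.2.2.le (c₀ L i) (cB L i) (a L i) (Δx L i) U₀ b‖ ≤ B₀ L * ‖b‖) :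
    ∀ (L : ℕ), 1 < L → ∀ (i : Idx L) (U₀ : GaugeField (i.1.1.P i.1.2.2) 0 (Matrix.specialUnitaryGroup (Fin 2) ℂ)), RegPr i.1.1 i.1.2.1 i.1.2.2 (α L) U₀ →
      ∀ (Y : PBond (i.1.1.P i.1.2.1) 0 → Matrix (Fin 2) (Fin 2) ℂ) (μ ν : Fin (i.1.1.P i.1.2.2).d) (x : Site (i.1.1.P i.1.2.2) 0),
        ‖covGradT 1 (bgUnits i.1.1 i.1.2.2 U₀) (Hf i.1.1 i.1.2.1 i.1.2.2 i.2.2.le (c₀ L i) (cB L i) (a L i) (Δx L i) U₀ Y) μ ν x‖ ≤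
          B₀ L * eta i.1.1 i.1.2.1 i.1.2.2 ^ 2 * ‖Y‖ :=
  fun L hL i U₀ hU => (h46_rows_of_norm115 i.1.1 i.1.2.1 i.1.2.2 i.2.2.le (c₀ L i) (cB L i) (a L i) (Δx L i) U₀ (norm_H L hL i (α L) U₀ hU le_rfl)).2

end Family

end Summit.QuantumFields.YangMills.Theorems.Prop7H46GradRow

end
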